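import Summits.CriticalPhenomena.Ising3DConformalLimit.Theses.HyperoctahedralRP
import Literature.MathematicalPhysics.QuantumFieldTheory.LatticeMirrorNormals
import Literature.MathematicalPhysics.QuantumFieldTheory.OSLorentzInvariance
import Literature.MathematicalPhysics.QuantumFieldTheory.PointwiseOSReconstruction
import HarnessLib

/-!
# Objects of the line `quarter-turn-liouville` for the crux `HyperoctahedralRP.LimitRotationInvariant`
(item stmt-CriticalPhenomena-1980; decl
`Summit.CriticalPhenomena.Ising3DConformalLimit.Theses.HyperoctahedralRP.LimitRotationInvariant`)

Route-posited vocabulary (D-0016: objects a route/line posits live in a reviewed `…Defs` file, never inside a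
proof file) of the checked skeleton `Cruxes/LimitRotationInvariant/Lines/quarter_turn_liouville.lean`
(lead `prover-line-stmt-CriticalPhenomena-1980-0`, reshaped 2026-08-16 from the crux-plan skeleton of
`planner-cruxplan-stmt-CriticalPhenomena-1980-quarter-turn-liouvil-0`).  Everything here is definitional
bookkeeping over tree declarations; the mathematics is in the stub files
`Theorems/HyperoctahedralRPLimitRotationInvariant*.lean` that import this module.

THE LINE.  For a configuration `x` of `n` points of `ℝ³` and the rotation `rot θ = planeRot 0 θ` about the
lattice axis `e₂`, the orbit function `θ ↦ S n (rot θ ∘ x)` of a normalised pointwise scaling limit `S` of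
the critical `ℤ³` Ising correlators is `π/2`-periodic (the quarter turn is a signed permutation, and every
such limit is hyperoctahedrally invariant), extends — by the Osterwalder–Schrader operator calculus of the
four lattice mirrors `⊥ e₂` with their speed-one in-plane light cone (`InPlaneLightCone`) and the two-sided
one-spin sandwich bound (`TwoSidedSigmaBound`, the open core) — to an ENTIRE function of exponential type
`2Δ ≤ 2 < 4`, hence is constant by the tree's Liouville theorem for periodic entire functions of small type
(`Literature.Analysis.Complex.apply_eq_apply_of_periodic_of_norm_le_exp`, period `π/2`, `type·π/2 < 2π`);
strong induction on `n` (base `n = 2` = crux (A) `HRP2Rigidity` through `TwoPointKernelOfLimit`) and a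
density/group-generation step give `IsRotationInvariant S`.

Contents: `CruxHyp` (the crux hypotheses, verbatim), `rot`, `signedPerm`, `IsHyperoctahedralInvariant`,
`refl`, `MirrorRP`, `NineMirrorRP`, `PairDominated`, `LimitRegularity`, `LimitStructure`, `coneTube`,
`InPlaneLightCone`, `TwoSidedSigmaBound`, `pdot`, `pcross`, `AxisGeneric`, `RotInvAt`, and their elementary API
(`rot_zero_apply`, `rot_add_pi_div_two` — the quarter turn is a signed permutation —, `orbit_periodic`, `pdot_rot`,
`pcross_rot`, `axisGeneric_rot`, `isRotationInvariant_iff_rotInvAt`).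
Mathlib/tree anchors: `Literature.MathematicalPhysics.QuantumFieldTheory.planeRot` (rotation in a
coordinate plane), `….latticeMirrorNormals` (the nine `B₃` normals), `….IsPermutationSymmetric` (E3),
`Submodule.reflection`, `Literature.Probability.LatticeModels.{CorrFamily, HasPointwiseScalingLimit,
criticalCorr, NonCoincident, IsNondegenerateTwoPoint, IsTranslationInvariant, IsScaleCovariant}`.

References: K. Osterwalder, R. Schrader, Comm. Math. Phys. 31 (1973) 83–112, §4 (reflection positivity,
reconstruction); J. Glimm, A. Jaffe, *Quantum Physics* (2nd ed. 1987), §6.1 and §19.5 (light cone of the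
transfer matrix); J. Fröhlich, R. Israel, E. H. Lieb, B. Simon, Comm. Math. Phys. 62 (1978) 1–34, §3
(reflection positivity in diagonal site planes); M. Jarnicki, P. Pflug, *Separately Analytic Functions*
(EMS 2011), cross theorem — the named fact `Literature.Uncategorized.DiamondCross` (relocated there by the gate from the first
submission of this file, p86234) is used by the skeleton directly and is deliberately NOT imported here.
-/

noncomputable section

open scoped BigOperators
open Literature.Probability.LatticeModels
open Literature.MathematicalPhysics.QuantumFieldTheory

namespace Summit.CriticalPhenomena.Ising3DConformalLimit.Cruxes.LimitRotationInvariant.QuarterTurnLiouville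

/-- The hypotheses of the crux `HyperoctahedralRP.LimitRotationInvariant` on a candidate limit `(ρ, Δ, S)`,
verbatim and in the crux's order: `ρ > 0` on `(0,1]`, `S` is the pointwise scaling limit of `criticalCorr 3`
under `ρ`, `S = 0` off `NonCoincident`, non-degenerate two-point function, translation invariance, scale
covariance with exponent `Δ`. [folklore] -/
def CruxHyp (ρ : ℝ → ℝ) (Δ : ℝ) (S : CorrFamily 3) : Prop :=
  (∀ δ ∈ Set.Ioc (0:ℝ) 1, 0 < ρ δ) ∧ HasPointwiseScalingLimit (criticalCorr 3) ρ S ∧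
  (∀ n z, z ∉ NonCoincident 3 n → S n z = 0) ∧ IsNondegenerateTwoPoint S ∧
  IsTranslationInvariant S ∧ IsScaleCovariant Δ S

/-- The rotation by the angle `θ` about the lattice axis `e₂` of `ℝ³`, as a linear isometry: the tree's
plane rotation `planeRot 0 θ` in the `(0,1)`-coordinate plane, `x₀ ↦ cos θ x₀ + sin θ x₁`,
`x₁ ↦ −sin θ x₀ + cos θ x₁`, `x₂ ↦ x₂`. [folklore] -/
abbrev rot (θ : ℝ) : EuclideanSpace ℝ (Fin 3) ≃ₗᵢ[ℝ] EuclideanSpace ℝ (Fin 3) :=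
  planeRot (d := 2) 0 θ

/-- The signed coordinate permutation `x ↦ (± x_{σ j})_j` (`ε j = true` for `+`): the 48 elements of the
hyperoctahedral group `O_h = B₃`, the point group of `ℤ³`. [folklore] -/
def signedPerm (σ : Equiv.Perm (Fin 3)) (ε : Fin 3 → Bool) (x : EuclideanSpace ℝ (Fin 3)) :
    EuclideanSpace ℝ (Fin 3) :=
  WithLp.toLp 2 (fun j => (if ε j then (1:ℝ) else -1) * x (σ j))

/-- Hyperoctahedral invariance of a correlation family on `ℝ³`: `S n (g ∘ x) = S n x` for every signed
coordinate permutation `g`. [folklore] -/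
def IsHyperoctahedralInvariant (S : CorrFamily 3) : Prop :=
  ∀ (n : ℕ) (σ : Equiv.Perm (Fin 3)) (ε : Fin 3 → Bool) (x : Fin n → EuclideanSpace ℝ (Fin 3)),
    S n (fun i => signedPerm σ ε (x i)) = S n x

/-- The mirror reflection `θ_n` in the hyperplane `n^⊥` through the origin (Mathlib `Submodule.reflection`,
exactly as in `HRP2Rigidity`). [folklore] -/
abbrev refl (n x : EuclideanSpace ℝ (Fin 3)) : EuclideanSpace ℝ (Fin 3) := ((ℝ ∙ n)ᗮ).reflection x

/-- Reflection positivity of a correlation family `S` in the mirror `n^⊥` (Osterwalder–Schrader positivity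
with 'time' direction `n`, pointwise form over finite clusters): for finitely many finite clusters `x a`
strictly inside the open half-space `⟪·, n⟫ > 0` and real coefficients `c a`,
`Σ_{a,b} c_a c_b S(θ_n x^a ⊔ x^b) ≥ 0`.  Clusters may be empty (the vacuum) and need not be injective (for
a normalised family non-injective clusters contribute `0`). (Osterwalder–Schrader 1973 (E2); Glimm–Jaffe
(6.1.8)–(6.1.11); Fröhlich–Israel–Lieb–Simon 1978 §3.) [folklore] -/
def MirrorRP (n : EuclideanSpace ℝ (Fin 3)) (S : CorrFamily 3) : Prop :=
  ∀ (m : ℕ) (k : Fin m → ℕ) (x : (a : Fin m) → Fin (k a) → EuclideanSpace ℝ (Fin 3)) (c : Fin m → ℝ),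
    (∀ a i, 0 < inner ℝ (x a i) n) →
    0 ≤ ∑ a, ∑ b, c a * c b * S (k a + k b) (Fin.append (fun i => refl n (x a i)) (x b))

/-- Nine-mirror reflection positivity: `MirrorRP n S` for each of the nine lattice mirror normals
`n ∈ latticeMirrorNormals (Fin 3)` (`e_i`, `e_i ± e_j`: the `B₃` arrangement). [folklore] -/
def NineMirrorRP (S : CorrFamily 3) : Prop :=
  ∀ n ∈ latticeMirrorNormals (Fin 3), MirrorRP n S

/-- Gaussian-domination a priori bound: if all pairwise distances of `x` are `≥ r > 0` then
`|S n x| ≤ C^(n+1) · n! · r^(-nΔ)` (for limits of `criticalCorr 3`: Newman's inequality in the limit and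
`S₂ ≤ C · dist^{-2Δ}`; the factor `C^(n+1)` absorbs `S 0 = 1` and the odd orders). [folklore] -/
def PairDominated (Δ : ℝ) (S : CorrFamily 3) : Prop :=
  ∃ C : ℝ, ∀ (n : ℕ) (x : Fin n → EuclideanSpace ℝ (Fin 3)) (r : ℝ), 0 < r →
    (∀ i j, i ≠ j → r ≤ ‖x i - x j‖) →
    |S n x| ≤ C ^ (n + 1) * (Nat.factorial n : ℝ) * r ^ (-(n : ℝ) * Δ)

/-- The model-independent structure of a limit consumed by the analytic stubs of the line, minus reflection
positivity: the window `1/2 ≤ Δ ≤ 1`, translation invariance, scale covariance, normalisation off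
`NonCoincident`, non-degeneracy, hyperoctahedral invariance, permutation symmetry (E3), Gaussian domination,
and continuity off the diagonals. [folklore] -/
def LimitRegularity (Δ : ℝ) (S : CorrFamily 3) : Prop :=
  (1/2 ≤ Δ ∧ Δ ≤ 1) ∧ IsTranslationInvariant S ∧ IsScaleCovariant Δ S ∧
  (∀ n z, z ∉ NonCoincident 3 n → S n z = 0) ∧ IsNondegenerateTwoPoint S ∧
  IsHyperoctahedralInvariant S ∧ IsPermutationSymmetric S ∧ PairDominated Δ S ∧
  (∀ n, ContinuousOn (S n) (NonCoincident 3 n))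

/-- Everything the analytic stubs consume about the limit: `LimitRegularity` and nine-mirror reflection
positivity. [folklore] -/
def LimitStructure (Δ : ℝ) (S : CorrFamily 3) : Prop :=
  LimitRegularity Δ S ∧ NineMirrorRP S

/-- The tube `{(t, y) ∈ ℂ² : |Im y| < Re t}` of the speed-one in-plane light cone. [folklore] -/
def coneTube : Set (ℂ × ℂ) := {p | |p.2.im| < p.1.re}

/-- IN-PLANE LIGHT CONE (operator content: `Spec(H_n, P_{n'}) ⊂ {|p| ≤ E}` on the frame-`n` OS space;
Glimm–Jaffe Cor. 19.5.4 derives it from rotation invariance, here it is an input to rotations).  For every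
`B₂` pair of lattice normals `(n, n')` — orthogonal and of equal length, i.e. `(e_i, e_j)` or
`(e_i + e_j, e_i - e_j)` up to order — and all finite real combinations of clusters on the two sides, the
two-cluster matrix element `(t, y) ↦ Σ c_a d_b S(θ_n A^a ⊔ (B^b + t n + y n'))` is the restriction to the
real points `t > 0, y ∈ ℝ` of a function holomorphic on the tube `|Im y| < Re t` and bounded there by the
product of the two OS norms. [folklore] -/
def InPlaneLightCone (S : CorrFamily 3) : Prop :=
  ∀ n ∈ latticeMirrorNormals (Fin 3), ∀ n' ∈ latticeMirrorNormals (Fin 3),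
    inner ℝ n n' = 0 → ‖n‖ = ‖n'‖ →
  ∀ (m : ℕ) (k : Fin m → ℕ) (A : (a : Fin m) → Fin (k a) → EuclideanSpace ℝ (Fin 3)) (c : Fin m → ℝ)
    (m' : ℕ) (k' : Fin m' → ℕ) (B : (b : Fin m') → Fin (k' b) → EuclideanSpace ℝ (Fin 3)) (d : Fin m' → ℝ),
    (∀ a i, 0 < inner ℝ (A a i) n) → (∀ b j, 0 < inner ℝ (B b j) n) →
    ∃ G : ℂ × ℂ → ℂ, DifferentiableOn ℂ G coneTube ∧
      (∀ t y : ℝ, 0 < t → G ((t : ℂ), (y : ℂ)) =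
        ((∑ a, ∑ b, c a * d b * S (k a + k' b)
          (Fin.append (fun i => refl n (A a i)) (fun j => B b j + t • n + y • n')) : ℝ) : ℂ)) ∧
      (∀ p ∈ coneTube, ‖G p‖ ^ 2 ≤
        (∑ a, ∑ a', c a * c a' * S (k a + k a') (Fin.append (fun i => refl n (A a i)) (A a'))) *
        (∑ b, ∑ b', d b * d b' * S (k' b + k' b') (Fin.append (fun j => refl n (B b j)) (B b'))))

/-- TWO-SIDED SIGMA BOUND (the open core of the line): in the OS space of any lattice frame `n`, one spin
inserted on the mirror plane between a bra cluster combination pushed to `n`-distance `≥ u` and a ket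
combination pushed to `n`-distance `≥ v` is bounded by `C (u^{-Δ} + v^{-Δ})` times the two OS norms — the
correlation-function form of `‖e^{-uH} σ̂(y) e^{-vH}‖ ≤ C (u^{-Δ} + v^{-Δ})` (true for the generalised
free field of dimension `Δ ≥ 1/2`). [folklore] -/
def TwoSidedSigmaBound (Δ : ℝ) (S : CorrFamily 3) : Prop :=
  ∀ n ∈ latticeMirrorNormals (Fin 3), ∃ C : ℝ, ∀ u v : ℝ, 0 < u → 0 < v →
  ∀ y : EuclideanSpace ℝ (Fin 3), inner ℝ y n = 0 →
  ∀ (m : ℕ) (k : Fin m → ℕ) (A : (a : Fin m) → Fin (k a) → EuclideanSpace ℝ (Fin 3)) (c : Fin m → ℝ)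
    (m' : ℕ) (k' : Fin m' → ℕ) (B : (b : Fin m') → Fin (k' b) → EuclideanSpace ℝ (Fin 3)) (d : Fin m' → ℝ),
    (∀ a i, 0 < inner ℝ (A a i) n) → (∀ b j, 0 < inner ℝ (B b j) n) →
    (∑ a, ∑ b, c a * d b * S (k a + 1 + k' b)
        (Fin.append (Fin.append (fun i => refl n (A a i + u • n)) ![y]) (fun j => B b j + v • n))) ^ 2
      ≤ (C * (u ^ (-Δ) + v ^ (-Δ))) ^ 2 *
        (∑ a, ∑ a', c a * c a' * S (k a + k a') (Fin.append (fun i => refl n (A a i)) (A a'))) *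
        (∑ b, ∑ b', d b * d b' * S (k' b + k' b') (Fin.append (fun j => refl n (B b j)) (B b')))

/-- Planar dot product of the projections to the coordinate plane `⊥ e₂`. [folklore] -/
def pdot (v w : EuclideanSpace ℝ (Fin 3)) : ℝ := v 0 * w 0 + v 1 * w 1

/-- Planar cross product of the projections to the coordinate plane `⊥ e₂`. [folklore] -/
def pcross (v w : EuclideanSpace ℝ (Fin 3)) : ℝ := v 0 * w 1 - v 1 * w 0

/-- AXIS-GENERIC configurations (for the axis `e₂`): distinct projections to the plane `⊥ e₂`, and no two
distinct pairs whose projected difference directions are orthogonal or differ by `π/4` (mod `π/2`).  Then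
for EVERY real angle `θ` one of the four frames `e₀, e₁, e₀ ± e₁` gives all points of `rot θ ∘ x` pairwise
distinct heights.  Open, dense, `rot`-invariant; its complement is a proper algebraic set. [folklore] -/
def AxisGeneric {n : ℕ} (x : Fin n → EuclideanSpace ℝ (Fin 3)) : Prop :=
  (∀ i j : Fin n, i ≠ j → (x i 0 ≠ x j 0 ∨ x i 1 ≠ x j 1)) ∧
  ∀ i j k l : Fin n, i ≠ j → k ≠ l → ¬ ((i = k ∧ j = l) ∨ (i = l ∧ j = k)) →
    pdot (x i - x j) (x k - x l) ≠ 0 ∧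
    pdot (x i - x j) (x k - x l) ^ 2 ≠ pcross (x i - x j) (x k - x l) ^ 2

/-- Full `O(3)` invariance of `S` at level `n` (so that `IsRotationInvariant S ↔ ∀ n, RotInvAt S n`).
[folklore] -/
def RotInvAt (S : CorrFamily 3) (n : ℕ) : Prop :=
  ∀ (R : EuclideanSpace ℝ (Fin 3) ≃ₗᵢ[ℝ] EuclideanSpace ℝ (Fin 3)) (x : Fin n → EuclideanSpace ℝ (Fin 3)),
    S n (fun i => R (x i)) = S n x


/-! ### Elementary API of the vocabulary (used by the skeleton's composition and by the stub provers) -/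

/-- The rotation by the angle `0` is the identity. [folklore] -/
theorem rot_zero_apply (v : EuclideanSpace ℝ (Fin 3)) : rot 0 v = v := by
  ext j
  fin_cases j <;> simp

/-- The quarter turn about `e₂` is hyperoctahedral: `rot (θ + π/2) = Q ∘ rot θ` with
`Q (y₀, y₁, y₂) = (y₁, -y₀, y₂) = signedPerm (swap 0 1) (+,-,+)` — the source of the period `π/2` of every orbit
function (registered sub-goal `rot_add_pi_div_two` of stmt-CriticalPhenomena-1980). [folklore] -/
theorem rot_add_pi_div_two :
    ∀ (θ : ℝ) (v : EuclideanSpace ℝ (Fin 3)),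
      rot (θ + Real.pi / 2) v = signedPerm (Equiv.swap 0 1) ![true, false, true] (rot θ v) := by
  intro θ v
  ext j
  fin_cases j
  · simp [signedPerm, Real.cos_add_pi_div_two, Real.sin_add_pi_div_two, Equiv.swap_apply_def]
  · simp [signedPerm, Real.cos_add_pi_div_two, Real.sin_add_pi_div_two, Equiv.swap_apply_def]
    ring
  · simp [signedPerm, Equiv.swap_apply_def]

/-- Hence every orbit function `θ ↦ S n (rot θ ∘ x)` of a hyperoctahedrally invariant family is `π/2`-periodic.
[folklore] -/
theorem orbit_periodic {S : CorrFamily 3} (hS : IsHyperoctahedralInvariant S) {n : ℕ}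
    (x : Fin n → EuclideanSpace ℝ (Fin 3)) (θ : ℝ) :
    S n (fun i => rot (θ + Real.pi / 2) (x i)) = S n (fun i => rot θ (x i)) := by
  simp only [rot_add_pi_div_two]
  exact hS n _ _ _

/-- The planar dot product of projections is invariant under `rot θ`. [folklore] -/
theorem pdot_rot (θ : ℝ) (a b : EuclideanSpace ℝ (Fin 3)) : pdot (rot θ a) (rot θ b) = pdot a b := by
  have h := Real.cos_sq_add_sin_sq θ
  simp only [pdot, planeRot_apply]
  simp
  linear_combination (a 0 * b 0 + a 1 * b 1) * h

/-- The planar cross product of projections is invariant under `rot θ`. [folklore] -/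
theorem pcross_rot (θ : ℝ) (a b : EuclideanSpace ℝ (Fin 3)) : pcross (rot θ a) (rot θ b) = pcross a b := by
  have h := Real.cos_sq_add_sin_sq θ
  simp only [pcross, planeRot_apply]
  simp
  linear_combination (a 0 * b 1 - a 1 * b 0) * h

/-- Axis-genericity is invariant under the rotations about the axis. [folklore] -/
theorem axisGeneric_rot {n : ℕ} {x : Fin n → EuclideanSpace ℝ (Fin 3)} (hx : AxisGeneric x) (θ : ℝ) :
    AxisGeneric (fun i => rot θ (x i)) := by
  obtain ⟨h1, h2⟩ := hx
  refine ⟨?_, ?_⟩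
  · intro i j hij
    by_contra hcon
    simp only [not_or, ne_eq, not_not] at hcon
    obtain ⟨hc0, hc1⟩ := hcon
    have hc := Real.cos_sq_add_sin_sq θ
    simp only [planeRot_apply] at hc0 hc1
    simp at hc0 hc1
    have e0 : x i 0 = x j 0 := by
      linear_combination Real.cos θ * hc0 - Real.sin θ * hc1 + (x j 0 - x i 0) * hc
    have e1 : x i 1 = x j 1 := by
      linear_combination Real.sin θ * hc0 + Real.cos θ * hc1 + (x j 1 - x i 1) * hc
    rcases h1 i j hij with h | h
    · exact h e0
    · exact h e1
  · intro i j k l hij hkl hne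
    have := h2 i j k l hij hkl hne
    simpa only [← map_sub, pdot_rot, pcross_rot] using this

/-- `IsRotationInvariant S ↔ ∀ n, RotInvAt S n` (by `Iff.rfl` up to currying). [folklore] -/
theorem isRotationInvariant_iff_rotInvAt (S : CorrFamily 3) : IsRotationInvariant S ↔ ∀ n, RotInvAt S n :=
  ⟨fun h n R x => h n R x, fun h n R x => h n R x⟩

end Summit.CriticalPhenomena.Ising3DConformalLimit.Cruxes.LimitRotationInvariant.QuarterTurnLiouville

end
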